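import Summits.QuantumFields.YangMills.Theorems.BalabanUVNodesN15TwoSpacingGluingCurvedKnitCovariantLandauNodeSmall
import Summits.QuantumFields.YangMills.Theorems.BalabanUVNodesN15CovariantLandauLetterExp
import Summits.QuantumFields.YangMills.Theorems.BalabanUVNodesN15CovariantAveragingSandwichSizes
import Summits.QuantumFields.YangMills.Theorems.BalabanUVNodesN15TwoSpacingGluingCurvedKnitSmallFieldDefect
import HarnessLib

/-!
# THE GLUING STEP AT TWO LATTICE SPACINGS — PROGRAMME (P-S), IX: NE2⁺ (OPERATOR LAYER) FOR THE GLUED FAMILY WITH BAŁABAN's FULLY COVARIANT SUMMAND LIVE, THE LANDAU LETTER's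
# ONE-GRID ROWS DERIVED — displayed: the four FLAT propagator rows per grid ([B6] Props. 2.2–2.3 = [B9] Thms 3.1–3.2 at `U ≡ 1`), the ONE covariant gradient-difference row per
# grid ([B9] Thm 3.4), the two-grid η-defect row, and entries 1–3 (dag-n15-c g23, n15-c∕219)

Cell `pub-ymgap`, seat `pub-ymgap-dag-n15-c` (R134 (a); HUMAN RULING D-0062), generation 23.  `bears_on: R4∕N15 · K3⁸ SpineGivenEndpointR13SepCoPHV (stmt-QuantumFields-27366)`.
Filed `--supports stmt-QuantumFields-27366 --as helper` — COUNT-NEUTRAL.  One theorem; 0 `sorry`; NO estimate of Bałaban's.  Imports BY NAME n15-c∕207b `…CovariantLandauNodeSmall`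
(`ne2PlusOperator_sfqr_of_global_small`), n15-c∕218 `…CovariantLandauLetterExp` (`hasMaj_landauCov_sub_exp_of_flat`, `landauExpThreshold`), n15-c∕210 (`isUnit_cvT₀`,
`CovLandau.landauCov_eq_of_mass`), n15-c∕200 (`CovLandau.landauCov_one_eq`), n15-c∕215 (`CovLandau.mulVecLin_sub'`), dag-n15-w3∕n15-a `SiteLayerSf.norm_gavgM_le_of_norm_le`,
`gavgM_conjTranspose_of_skew`, `sfInstance_reg335_iff`, `l2_opNorm_le_frobenius_norm`, `blkFine_comp_kingPrV`.  Nothing in the tree is modified.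

WHY (HOME HANDOFF g22 «LOCATED NEXT OBJECT»; ref-J READ-500 on n15-c∕211: the Landau letter's rows were pure hypotheses).  n15-c∕211∕207b display THREE global rows of `N_V^R` per index;
n15-c∕212–218 derive the two ONE-GRID rows from printed-shape PRIMITIVE propagator rows.  THIS FILE is the node edition: `NE2PlusOperator c₃₅ (sfInstance …) (sfqrFamily …)` from
(`hE`) entries 1–3 as in 207; (`hF`) ∀ index, on BOTH grids of the cover, at the unit-weight mass `a = n^{d+1}`: the four FLAT rows `G′(1) ≤ C_Ge^{−δd}`, `G′(1)∂ᵀ ≤ C_Ae^{−δd}`,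
`∂G′(1) ≤ C_De^{−δd}`, `(Q′G′²Q′ᵀ)⁻¹(1) ≤ C_Sn^{d+1}e^{−δd}` and, for class-(3.35) fields below a threshold, the covariant gradient difference `D_TG′(T) − ∂G′(1) ≤ P₀·c₃₅L^mα₀·e^{−δd}` at the
knit's transporters (`T = coordMat e Ad_U`, `U = e^{ηĀ}` coarse ∕ `e^{η′A′}` fine); (`hD`) the two-grid η-defect row of `N_V^R` (211's third row, thresholded).  The mass is moved to the
knit's `a` by n15-c∕210 (the Landau term is mass-free), the transporter letters are discharged by n15-c∕218, the rows by n15-c∕217, the node by n15-c∕207b.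
* ★★★ **`ne2PlusOperator_sfqr_of_flatRows`** (mass `n^{d+1}`); v1.1 ★★★ `ne2PlusOperator_sfqr_of_flatRows_mass` (masses `a_w·n^{d+1}`, `0 < a_w ≤ 1`, chosen per index and grid).

HONEST FRAMING ∕ LIMITS.  Plumbing on MODEL carriers (doubled-torus cover, global small-field gauge, one averaging level, site transporters); the flat rows, the gradient-difference rows,
the two-grid defect row and entries 1–3 are HYPOTHESES; NOT [Balaban1985BackgroundPropagators] Thm 3.1∕3.14 as printed; NE2⁺ NOT PRINTED; N15 of record untouched (DISCHARGED AS
CONSUMED, p687738); counts UNMOVED (typed 28∕28 · discharged 8∕27); one finite 𝕋⁴ at fixed ε per index — NOT infinite volume ∕ OS ∕ mass gap ∕ Clay.  Restate-immune (no Theses import).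
-/

noncomputable section

open scoped BigOperators Matrix

namespace Summit.QuantumFields.YangMills.BalabanUVNodes.N15.Gluing

open Literature.MathematicalPhysics.QuantumFieldTheory.Balaban1983to89
open Literature.MathematicalPhysics.QuantumFieldTheory.Balaban1983to89.B11SectG (BlockNorm HasMaj)
open Literature.MathematicalPhysics.QuantumFieldTheory.Balaban1983to89.T4EtaRateDefect (idef)
open Literature.MathematicalPhysics.QuantumFieldTheory.Balaban1983to89.T4EtaRateCoeffDefect (pull)
open Literature.MathematicalPhysics.QuantumFieldTheory.Balaban1983to89.B6UnitTorusCarrier (unitTorusGeo unitTorusGeo_dist_nonneg)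
open Literature.MathematicalPhysics.QuantumFieldTheory.Balaban1983to89.B5Prop11Plancherel (Tor fine)
open Literature.MathematicalPhysics.QuantumFieldTheory.Balaban1983to89.T4EtaRate (NE2PlusOperator rateFactor)
open Literature.MathematicalPhysics.QuantumFieldTheory.King1986.Torus (blockOf tdistT)
open Literature.Barriers.QuantumFields (traceForm)
open Summit.QuantumFields.YangMills.BalabanUVNodes.N15.BackgroundLayer (gavgM)
open Summit.QuantumFields.YangMills.BalabanUVNodes.N15.VectorPiece (kingPrV blkFine_comp_kingPrV)
open Summit.QuantumFields.YangMills.BalabanUVNodes.N15.MatrixSpecies (liftBlk liftMap basisConst basisConst_nonneg)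
open Summit.QuantumFields.YangMills.BalabanUVNodes.N15.OperatorReadout (opGeo)
open Summit.QuantumFields.YangMills.BalabanUVNodes.N15.CovLandau (cgrad csavg cGreen cSop landauCov landauSmallConst landauRowConst landauLetterConst_nonneg landauCov_eq_of_mass landauCov_one_eq mulVecLin_sub')
open Summit.QuantumFields.YangMills.BalabanUVNodes.N15.CurvedSpecies (exp_smul_unitary_of_conjTranspose)
open Summit.QuantumFields.YangMills.BalabanUVNodes.N15.SiteLayerSf (norm_gavgM_le_of_norm_le)

variable {d : ℕ} {L : ℕ} [NeZero L]

section Node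

open scoped Matrix.Norms.L2Operator

variable (d) (mm ι : Type) [Fintype mm] [DecidableEq mm] [Nonempty mm] [Fintype ι] [DecidableEq ι] (e : Matrix mm mm ℂ ≃L[ℝ] (ι → ℝ))

/-- ★★★ **NE2⁺, OPERATOR LAYER, BY NAME, FOR THE GLUED FAMILY WITH BAŁABAN's FULLY COVARIANT SUMMAND LIVE — THE LANDAU LETTER's ONE-GRID ROWS DERIVED FROM PRIMITIVE PROPAGATOR ROWS.**
n15-c∕207b fed, for every index and class-(3.35) field below the threshold, by n15-c∕218 on both grids (mass moved by n15-c∕210): displayed are the FOUR FLAT rows per grid at the unit-weight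
mass (`hF`, first two blocks), the ONE covariant gradient-difference row per grid (`hF`, third block), the two-grid η-defect row (`hD`) and entries 1–3 (`hE`).  MODEL family; NOT [B9] Thm 3.1∕3.14 as printed.
[cite: Balaban1985BackgroundPropagators, Thm 3.1 (3.42) p.397, Thm 3.2 (3.48) p.398, (3.49) p.399, Thm 3.4 p.400, (3.25)–(3.26) pp.394–395, (3.35)–(3.37) p.396, Thm 3.14 pp.426–427; Balaban1984PropagatorsII, Props. 2.2–2.3 pp.228–231 (the flat rows' shape); King1986, Prop. 3.9 (3.73) p.665] -/
theorem ne2PlusOperator_sfqr_of_flatRows (hL : Odd L ∧ 1 < L) (hL7 : 7 ≤ L) {a : ℝ} (ha : 0 < a) {c35 : ℝ} (hc35 : 0 < c35) (he : ∀ A B : Matrix mm mm ℂ, traceForm A B = e A ⬝ᵥ e B)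
    (E : ∀ i : SfIdx d L, Fin 4 → (Fin (d + 1) → CvX' d L i.m i.kk i.r hL → Matrix mm mm ℂ) → ((CvX d L i.m i.kk hL × ι → ℝ) →ₗ[ℝ] (CvX' d L i.m i.kk i.r hL × ι → ℝ)))
    (hE : ∃ M₁ δ₁ a₁ B₁ γ₁ : ℝ, 0 < M₁ ∧ 0 < δ₁ ∧ 0 < a₁ ∧ 0 < B₁ ∧ 0 < γ₁ ∧
      ∀ i : SfIdx d L, M₁ ≤ (L : ℝ) ^ i.m → ∀ α₀ : ℝ, 0 < α₀ → (L : ℝ) ^ i.m * α₀ ≤ a₁ →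
        ∀ A' : Fin (d + 1) → CvX' d L i.m i.kk i.r hL → Matrix mm mm ℂ, (sfInstance d mm ι hL i).Bf.Reg335 c35 α₀ A' → ∀ n : Fin 4, n ≠ 0 →
          HasMaj (BlockNorm.ofBlocks (sfGeo d hL i) (liftBlk (cvBlk d L i.m i.kk hL) ι))
            (BlockNorm.ofBlocks (sfGeo d hL i) (liftBlk (cvBlk d L i.m i.kk hL ∘ kingPrV L i.kk i.r (cvM d L i.m i.kk hL)) ι)) (E i n A')
            (fun y y' => B₁ * B9.pref4 ((opGeo (sfGeo d hL i) (CvX d L i.m i.kk hL × ι) (liftBlk (cvBlk d L i.m i.kk hL) ι)).len y) n * Real.exp (-(δ₁ * (sfGeo d hL i).dist y y')) *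
              max (rateFactor (opGeo (sfGeo d hL i) (CvX d L i.m i.kk hL × ι) (liftBlk (cvBlk d L i.m i.kk hL) ι)) γ₁ y)
                (rateFactor (opGeo (sfGeo d hL i) (CvX d L i.m i.kk hL × ι) (liftBlk (cvBlk d L i.m i.kk hL) ι)) γ₁ y')))
    (hF : ∃ δF CG CA CD CS P0 aP : ℝ, 0 < δF ∧ 0 ≤ CG ∧ 0 ≤ CA ∧ 0 ≤ CD ∧ 0 ≤ CS ∧ 0 ≤ P0 ∧ 0 < aP ∧ ∀ i : SfIdx d L,
        (HasMaj (BlockNorm.ofBlocks (unitTorusGeo L i.kk (cvM d L i.m i.kk hL)) (liftBlk (blockOf (L ^ i.kk) (cvM d L i.m i.kk hL)) ι)) (BlockNorm.ofBlocks (unitTorusGeo L i.kk (cvM d L i.m i.kk hL)) (liftBlk (blockOf (L ^ i.kk) (cvM d L i.m i.kk hL)) ι)) (Matrix.mulVecLin (cGreen (cvM d L i.m i.kk hL) (L ^ i.kk) (fun (_ : Fin (d + 1)) (_ : Tor (fine (L ^ i.kk) (cvM d L i.m i.kk hL))) => (1 : Matrix ι ι ℝ)) (((L ^ i.kk : ℕ)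 : ℝ) ^ (d + 1)))) (fun y y' => CG * Real.exp (-(δF * (unitTorusGeo L i.kk (cvM d L i.m i.kk hL)).dist y y'))) ∧
          HasMaj (BlockNorm.ofBlocks (unitTorusGeo L i.kk (cvM d L i.m i.kk hL)) (liftBlk (fun b : Tor (fine (L ^ i.kk) (cvM d L i.m i.kk hL)) × Fin (d + 1) => blockOf (L ^ i.kk) (cvM d L i.m i.kk hL) b.1) ι)) (BlockNorm.ofBlocks (unitTorusGeo L i.kk (cvM d L i.m i.kk hL)) (liftBlk (blockOf (L ^ i.kk) (cvM d L i.m i.kk hL)) ι)) (Matrix.mulVecLin (cGreen (cvM d L i.m i.kk hL) (L ^ i.kk) (fun (_ : Fin (d + 1)) (_ : Tor (fine (L ^ i.kk) (cvM d L i.m i.kk hL))) => (1 : Matrix ι ι ℝ)) (((L ^ i.kk : ℕ) : ℝ) ^ (d + 1)) * (cgrad (cvM d L i.m i.kk hL) (L ^ i.kk) (fun (_ : Fin (d + 1)) (_ : Tor (fine (L ^ i.kk) (cvM d L i.m i.kk hL))) => (1 : Matrix ι ι ℝ)))ᵀ)) (fun y y' => CA * Real.exp (-(δF * (unitTorusGeo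 L i.kk (cvM d L i.m i.kk hL)).dist y y'))) ∧
          HasMaj (BlockNorm.ofBlocks (unitTorusGeo L i.kk (cvM d L i.m i.kk hL)) (liftBlk (blockOf (L ^ i.kk) (cvM d L i.m i.kk hL)) ι)) (BlockNorm.ofBlocks (unitTorusGeo L i.kk (cvM d L i.m i.kk hL)) (liftBlk (fun b : Tor (fine (L ^ i.kk) (cvM d L i.m i.kk hL)) × Fin (d + 1) => blockOf (L ^ i.kk) (cvM d L i.m i.kk hL) b.1) ι)) (Matrix.mulVecLin (cgrad (cvM d L i.m i.kk hL) (L ^ i.kk) (fun (_ : Fin (d + 1)) (_ : Tor (fine (L ^ i.kk) (cvM d L i.m i.kk hL))) => (1 : Matrix ι ι ℝ)) * cGreen (cvM d L i.m i.kk hL) (L ^ i.kk) (fun (_ : Fin (d + 1)) (_ : Tor (fine (L ^ i.kk) (cvM d L i.m i.kk hL))) => (1 : Matrix ι ι ℝ)) (((L ^ i.kk : ℕ) : ℝ) ^ (d + 1)))) (fun y y' => CD * Real.exp (-(δF * (unitTorusGeo L i.kk (cvM d L i.m i.kk hL)).dist y y'))) ∧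
          HasMaj (BlockNorm.ofBlocks (unitTorusGeo L i.kk (cvM d L i.m i.kk hL)) (liftBlk (fun y : Tor (cvM d L i.m i.kk hL) => y) ι)) (BlockNorm.ofBlocks (unitTorusGeo L i.kk (cvM d L i.m i.kk hL)) (liftBlk (fun y : Tor (cvM d L i.m i.kk hL) => y) ι)) (Matrix.mulVecLin (cSop (cvM d L i.m i.kk hL) (L ^ i.kk) (fun (_ : Fin (d + 1)) (_ : Tor (fine (L ^ i.kk) (cvM d L i.m i.kk hL))) => (1 : Matrix ι ι ℝ)) (((L ^ i.kk : ℕ) : ℝ) ^ (d + 1)))⁻¹) (fun y y' => CS * ((L ^ i.kk : ℕ) : ℝ) ^ (d + 1) * Real.exp (-(δF * (unitTorusGeo L i.kk (cvM d L i.m i.kk hL)).dist y y')))) ∧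
        (HasMaj (BlockNorm.ofBlocks (unitTorusGeo L i.kk (cvM d L i.m i.kk hL)) (liftBlk (blockOf (L ^ i.r * L ^ i.kk) (cvM d L i.m i.kk hL)) ι)) (BlockNorm.ofBlocks (unitTorusGeo L i.kk (cvM d L i.m i.kk hL)) (liftBlk (blockOf (L ^ i.r * L ^ i.kk) (cvM d L i.m i.kk hL)) ι)) (Matrix.mulVecLin (cGreen (cvM d L i.m i.kk hL) (L ^ i.r * L ^ i.kk) (fun (_ : Fin (d + 1)) (_ : Tor (fine (L ^ i.r * L ^ i.kk) (cvM d L i.m i.kk hL))) => (1 : Matrix ι ι ℝ)) (((L ^ i.r * L ^ i.kk : ℕ) : ℝ) ^ (d + 1)))) (fun y y' => CG * Real.exp (-(δF * (unitTorusGeo L i.kk (cvM d L i.m i.kk hL)).dist y y'))) ∧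
          HasMaj (BlockNorm.ofBlocks (unitTorusGeo L i.kk (cvM d L i.m i.kk hL)) (liftBlk (fun b : Tor (fine (L ^ i.r * L ^ i.kk) (cvM d L i.m i.kk hL)) × Fin (d + 1) => blockOf (L ^ i.r * L ^ i.kk) (cvM d L i.m i.kk hL) b.1) ι)) (BlockNorm.ofBlocks (unitTorusGeo L i.kk (cvM d L i.m i.kk hL)) (liftBlk (blockOf (L ^ i.r * L ^ i.kk) (cvM d L i.m i.kk hL)) ι)) (Matrix.mulVecLin (cGreen (cvM d L i.m i.kk hL) (L ^ i.r * L ^ i.kk) (fun (_ : Fin (d + 1)) (_ : Tor (fine (L ^ i.r * L ^ i.kk) (cvM d L i.m i.kk hL))) => (1 : Matrix ι ι ℝ)) (((L ^ i.r * L ^ i.kk : ℕ) : ℝ) ^ (d + 1)) * (cgrad (cvM d L i.m i.kk hL) (L ^ i.r * L ^ i.kk) (fun (_ : Fin (d + 1)) (_ : Tor (fine (L ^ i.r * L ^ i.kk) (cvM d L i.m i.kk hL))) => (1 : Matrix ι ι ℝ)))ᵀ)) (fun y y' => CA * Real.exp (-(δF * (unitTorusGeo L i.kk (cvM d L i.m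 i.kk hL)).dist y y'))) ∧
          HasMaj (BlockNorm.ofBlocks (unitTorusGeo L i.kk (cvM d L i.m i.kk hL)) (liftBlk (blockOf (L ^ i.r * L ^ i.kk) (cvM d L i.m i.kk hL)) ι)) (BlockNorm.ofBlocks (unitTorusGeo L i.kk (cvM d L i.m i.kk hL)) (liftBlk (fun b : Tor (fine (L ^ i.r * L ^ i.kk) (cvM d L i.m i.kk hL)) × Fin (d + 1) => blockOf (L ^ i.r * L ^ i.kk) (cvM d L i.m i.kk hL) b.1) ι)) (Matrix.mulVecLin (cgrad (cvM d L i.m i.kk hL) (L ^ i.r * L ^ i.kk) (fun (_ : Fin (d + 1)) (_ : Tor (fine (L ^ i.r * L ^ i.kk) (cvM d L i.m i.kk hL))) => (1 : Matrix ι ι ℝ)) * cGreen (cvM d L i.m i.kk hL) (L ^ i.r * L ^ i.kk) (fun (_ : Fin (d + 1)) (_ : Tor (fine (L ^ i.r * L ^ i.kk) (cvM d L i.m i.kk hL))) => (1 : Matrix ι ι ℝ)) (((L ^ i.r * L ^ i.kk : ℕ) : ℝ) ^ (d + 1)))) (fun y y' => CD * Real.exp (-(δF * (unitTorusGeo L i.kk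 (cvM d L i.m i.kk hL)).dist y y'))) ∧
          HasMaj (BlockNorm.ofBlocks (unitTorusGeo L i.kk (cvM d L i.m i.kk hL)) (liftBlk (fun y : Tor (cvM d L i.m i.kk hL) => y) ι)) (BlockNorm.ofBlocks (unitTorusGeo L i.kk (cvM d L i.m i.kk hL)) (liftBlk (fun y : Tor (cvM d L i.m i.kk hL) => y) ι)) (Matrix.mulVecLin (cSop (cvM d L i.m i.kk hL) (L ^ i.r * L ^ i.kk) (fun (_ : Fin (d + 1)) (_ : Tor (fine (L ^ i.r * L ^ i.kk) (cvM d L i.m i.kk hL))) => (1 : Matrix ι ι ℝ)) (((L ^ i.r * L ^ i.kk : ℕ) : ℝ) ^ (d + 1)))⁻¹) (fun y y' => CS * ((L ^ i.r * L ^ i.kk : ℕ) : ℝ) ^ (d + 1) * Real.exp (-(δF * (unitTorusGeo L i.kk (cvM d L i.m i.kk hL)).dist y y')))) ∧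
        (∀ α₀ : ℝ, 0 < α₀ → (L : ℝ) ^ i.m * α₀ ≤ aP → ∀ A' : Fin (d + 1) → CvX' d L i.m i.kk i.r hL → Matrix mm mm ℂ, (sfInstance d mm ι hL i).Bf.Reg335 c35 α₀ A' →
          HasMaj (BlockNorm.ofBlocks (unitTorusGeo L i.kk (cvM d L i.m i.kk hL)) (liftBlk (blockOf (L ^ i.kk) (cvM d L i.m i.kk hL)) ι)) (BlockNorm.ofBlocks (unitTorusGeo L i.kk (cvM d L i.m i.kk hL)) (liftBlk (fun b : Tor (fine (L ^ i.kk) (cvM d L i.m i.kk hL)) × Fin (d + 1) => blockOf (L ^ i.kk) (cvM d L i.m i.kk hL) b.1) ι)) (Matrix.mulVecLin (cgrad (cvM d L i.m i.kk hL) (L ^ i.kk) (cvT₀ e (fun μ x => NormedSpace.exp (((((L ^ i.kk : ℕ) : ℝ))⁻¹) • gavgM (Matrix mm mm ℂ) (Fin (d + 1)) (kingPrV L i.kk i.r (cvM d L i.m i.kk hL)) A' μ x))) * cGreen (cvM d L i.m i.kk hL) (L ^ i.kk) (cvT₀ e (fun μ x => NormedSpace.exp (((((L ^ i.kk : ℕ)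 : ℝ))⁻¹) • gavgM (Matrix mm mm ℂ) (Fin (d + 1)) (kingPrV L i.kk i.r (cvM d L i.m i.kk hL)) A' μ x))) (((L ^ i.kk : ℕ) : ℝ) ^ (d + 1)) - cgrad (cvM d L i.m i.kk hL) (L ^ i.kk) (fun (_ : Fin (d + 1)) (_ : Tor (fine (L ^ i.kk) (cvM d L i.m i.kk hL))) => (1 : Matrix ι ι ℝ)) * cGreen (cvM d L i.m i.kk hL) (L ^ i.kk) (fun (_ : Fin (d + 1)) (_ : Tor (fine (L ^ i.kk) (cvM d L i.m i.kk hL))) => (1 : Matrix ι ι ℝ)) (((L ^ i.kk : ℕ) : ℝ) ^ (d + 1)))) (fun y y' => P0 * (c35 * (L : ℝ) ^ i.m * α₀) * Real.exp (-(δF * (unitTorusGeo L i.kk (cvM d L i.m i.kk hL)).dist y y'))) ∧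
          HasMaj (BlockNorm.ofBlocks (unitTorusGeo L i.kk (cvM d L i.m i.kk hL)) (liftBlk (blockOf (L ^ i.r * L ^ i.kk) (cvM d L i.m i.kk hL)) ι)) (BlockNorm.ofBlocks (unitTorusGeo L i.kk (cvM d L i.m i.kk hL)) (liftBlk (fun b : Tor (fine (L ^ i.r * L ^ i.kk) (cvM d L i.m i.kk hL)) × Fin (d + 1) => blockOf (L ^ i.r * L ^ i.kk) (cvM d L i.m i.kk hL) b.1) ι)) (Matrix.mulVecLin (cgrad (cvM d L i.m i.kk hL) (L ^ i.r * L ^ i.kk) (cvT₀ e (fun μ x' => NormedSpace.exp (((((L ^ i.r * L ^ i.kk : ℕ) : ℝ))⁻¹) • A' μ x'))) * cGreen (cvM d L i.m i.kk hL) (L ^ i.r * L ^ i.kk) (cvT₀ e (fun μ x' => NormedSpace.exp (((((L ^ i.r * L ^ i.kk : ℕ) : ℝ))⁻¹) • A' μ x'))) (((L ^ i.r * L ^ i.kk : ℕ) : ℝ) ^ (d + 1)) - cgrad (cvM d L i.m i.kk hL) (L ^ i.r * L ^ i.kk) (fun (_ : Fin (d + 1)) (_ : Tor (fine (L ^ i.r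 * L ^ i.kk) (cvM d L i.m i.kk hL))) => (1 : Matrix ι ι ℝ)) * cGreen (cvM d L i.m i.kk hL) (L ^ i.r * L ^ i.kk) (fun (_ : Fin (d + 1)) (_ : Tor (fine (L ^ i.r * L ^ i.kk) (cvM d L i.m i.kk hL))) => (1 : Matrix ι ι ℝ)) (((L ^ i.r * L ^ i.kk : ℕ) : ℝ) ^ (d + 1)))) (fun y y' => P0 * (c35 * (L : ℝ) ^ i.m * α₀) * Real.exp (-(δF * (unitTorusGeo L i.kk (cvM d L i.m i.kk hL)).dist y y')))))
    (hD : ∃ δD CR γR aD : ℝ, 0 < δD ∧ 0 ≤ CR ∧ 0 < γR ∧ 0 < aD ∧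
      ∀ i : SfIdx d L, ∀ α₀ : ℝ, 0 < α₀ → (L : ℝ) ^ i.m * α₀ ≤ aD → ∀ A' : Fin (d + 1) → CvX' d L i.m i.kk i.r hL → Matrix mm mm ℂ, (sfInstance d mm ι hL i).Bf.Reg335 c35 α₀ A' →
        HasMaj (CvNorm d L i.m i.kk hL ι) (BlockNorm.ofBlocks (unitTorusGeo L i.kk (cvM d L i.m i.kk hL)) (liftBlk (cvBlk d L i.m i.kk hL ∘ (kingPrV L i.kk i.r (cvM d L i.m i.kk hL))) ι)) (idef (pull (liftMap (kingPrV L i.kk i.r (cvM d L i.m i.kk hL)) ι)) (pull (liftMap (kingPrV L i.kk i.r (cvM d L i.m i.kk hL)) ι)) (cvNVr' d L i.m i.kk i.r hL a ι e (fun μ x' => NormedSpace.exp (((((L ^ i.r * L ^ i.kk : ℕ) : ℝ))⁻¹) • A' μ x'))) (cvNVr d L i.m i.kk hL a ι e (fun μ x => NormedSpace.exp (((((L ^ i.kk : ℕ) : ℝ))⁻¹) • gavgM (Matrix mm mm ℂ) (Fin (d + 1)) (kingPrV L i.kk i.r (cvM d L i.m i.kk hL)) A' μ x)))) (fun y y'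 => (CR * ((L : ℝ) ^ i.kk) ^ (-γR)) * Real.exp (-(δD * (unitTorusGeo L i.kk (cvM d L i.m i.kk hL)).dist y y')))) :
    NE2PlusOperator c35 (sfInstance d mm ι hL) (fun i => sfqrFamily d mm ι a e hL i (E i)) := by
  obtain ⟨δF, CG, CA, CD, CS, P0, aP, hδF, hCG, hCA, hCD, hCS, hP0, haP, hF⟩ := hF
  obtain ⟨δD, CR, γR, aD, hδD, hCR, hγR, haD, hD⟩ := hD
  have hLpos : 0 < L := Nat.pos_of_ne_zero (NeZero.ne L)
  have hLr : (0 : ℝ) < (L : ℝ) := Nat.cast_pos.mpr hLpos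
  -- the constants of n15-c∕218 (index-free)
  have hκF := @basisConst_nonneg ι _ (Matrix mm mm ℂ) Matrix.frobeniusNormedAddCommGroup Matrix.frobeniusNormedSpace e
  have hκm : (0 : ℝ) ≤ (@basisConst ι _ (Matrix mm mm ℂ) Matrix.frobeniusNormedAddCommGroup Matrix.frobeniusNormedSpace e * (2 * Real.sqrt (Fintype.card mm)) * Real.sqrt (Fintype.card mm)) := by positivity
  have hcs : 0 ≤ B4Sect5Proof.latticeConst (d + 1) (δF / 16) := B4Sect5Proof.latticeConst_nonneg (d + 1) (by positivity)
  have hcs' : 0 ≤ B4Sect5Proof.latticeConst (d + 1) (3 * δF / 4 / 8) := B4Sect5Proof.latticeConst_nonneg (d + 1) (by positivity)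
  have hS : 0 ≤ landauSmallConst ((d : ℝ) + 1) (Fintype.card ι) CG CA CD CS P0 (2 * Fintype.card ι * (@basisConst ι _ (Matrix mm mm ℂ) Matrix.frobeniusNormedAddCommGroup Matrix.frobeniusNormedSpace e * (2 * Real.sqrt (Fintype.card mm)) * Real.sqrt (Fintype.card mm))) (2 * ((d : ℝ) + 1) * (2 * Fintype.card ι * (@basisConst ι _ (Matrix mm mm ℂ) Matrix.frobeniusNormedAddCommGroup Matrix.frobeniusNormedSpace e * (2 * Real.sqrt (Fintype.card mm)) * Real.sqrt (Fintype.card mm)))) 1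
      (B4Sect5Proof.latticeConst (d + 1) (δF / 16)) δF := by
    unfold landauSmallConst CovLandau.cK1 CovLandau.cB0 CovLandau.cM2 CovLandau.cPG0 CovLandau.cA0; positivity
  have hthr : 0 < landauExpThreshold ((d : ℝ) + 1) (Fintype.card ι) (@basisConst ι _ (Matrix mm mm ℂ) Matrix.frobeniusNormedAddCommGroup Matrix.frobeniusNormedSpace e * (2 * Real.sqrt (Fintype.card mm)) * Real.sqrt (Fintype.card mm)) CG CA CD CS P0 (B4Sect5Proof.latticeConst (d + 1) (δF / 16)) δF := by
    unfold landauExpThreshold; positivity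
  have hcR : 0 ≤ landauRowConst ((d : ℝ) + 1) (Fintype.card ι) CG CA CD CS P0 (2 * Fintype.card ι * (@basisConst ι _ (Matrix mm mm ℂ) Matrix.frobeniusNormedAddCommGroup Matrix.frobeniusNormedSpace e * (2 * Real.sqrt (Fintype.card mm)) * Real.sqrt (Fintype.card mm))) (2 * ((d : ℝ) + 1) * (2 * Fintype.card ι * (@basisConst ι _ (Matrix mm mm ℂ) Matrix.frobeniusNormedAddCommGroup Matrix.frobeniusNormedSpace e * (2 * Real.sqrt (Fintype.card mm)) * Real.sqrt (Fintype.card mm)))) 1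
      (B4Sect5Proof.latticeConst (d + 1) (δF / 16)) (B4Sect5Proof.latticeConst (d + 1) (3 * δF / 4 / 8)) δF := by
    unfold landauRowConst
    exact landauLetterConst_nonneg (by positivity) (by positivity) hcs' (by positivity) (by unfold CovLandau.cM2 CovLandau.cA0; positivity) hCD hP0
      (by unfold CovLandau.cPG0 CovLandau.cA0; positivity) (by norm_num) (by positivity)
  refine ne2PlusOperator_sfqr_of_global_small d mm ι e hL hL7 ha hc35 he E hE
    ⟨min (3 * δF / 8) δD, _, CR, γR, min aP (min aD (landauExpThreshold ((d : ℝ) + 1) (Fintype.card ι) (@basisConst ι _ (Matrix mm mm ℂ) Matrix.frobeniusNormedAddCommGroup Matrix.frobeniusNormedSpace e * (2 * Real.sqrt (Fintype.card mm)) * Real.sqrt (Fintype.card mm)) CG CA CD CS P0 (B4Sect5Proof.latticeConst (d + 1) (δF / 16)) δF / c35)),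
      lt_min (by positivity) hδD, hcR, hCR, hγR, lt_min haP (lt_min haD (by positivity)), fun i α₀ hα₀ hMa A' hA' => ?_⟩
  -- the class, the sizes
  have hMaP : (L : ℝ) ^ i.m * α₀ ≤ aP := hMa.trans (min_le_left _ _)
  have hMaD : (L : ℝ) ^ i.m * α₀ ≤ aD := hMa.trans ((min_le_right _ _).trans (min_le_left _ _))
  have hMaT : (L : ℝ) ^ i.m * α₀ ≤ landauExpThreshold ((d : ℝ) + 1) (Fintype.card ι) (@basisConst ι _ (Matrix mm mm ℂ) Matrix.frobeniusNormedAddCommGroup Matrix.frobeniusNormedSpace e * (2 * Real.sqrt (Fintype.card mm)) * Real.sqrt (Fintype.card mm)) CG CA CD CS P0 (B4Sect5Proof.latticeConst (d + 1) (δF / 16)) δF / c35 :=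
    hMa.trans ((min_le_right _ _).trans (min_le_right _ _))
  have hrA0 : 0 ≤ c35 * (L : ℝ) ^ i.m * α₀ := by positivity
  have hrT : c35 * (L : ℝ) ^ i.m * α₀ ≤ landauExpThreshold ((d : ℝ) + 1) (Fintype.card ι) (@basisConst ι _ (Matrix mm mm ℂ) Matrix.frobeniusNormedAddCommGroup Matrix.frobeniusNormedSpace e * (2 * Real.sqrt (Fintype.card mm)) * Real.sqrt (Fintype.card mm)) CG CA CD CS P0 (B4Sect5Proof.latticeConst (d + 1) (δF / 16)) δF := by
    have := mul_le_mul_of_nonneg_left hMaT hc35.le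
    rw [mul_div_cancel₀ _ hc35.ne'] at this
    simpa only [mul_assoc] using this
  obtain ⟨hskew, h1F, h2F, h3F⟩ := (sfInstance_reg335_iff d mm ι hL i c35 α₀ A').1 hA'
  have h1 : ∀ μ x', ‖A' μ x'‖ ≤ c35 * (L : ℝ) ^ i.m * α₀ := fun μ x' => (l2_opNorm_le_frobenius_norm _).trans (h1F μ x')
  have hĀs : ∀ μ x, (gavgM (Matrix mm mm ℂ) (Fin (d + 1)) (kingPrV L i.kk i.r (cvM d L i.m i.kk hL)) A' μ x)ᴴ = -gavgM (Matrix mm mm ℂ) (Fin (d + 1)) (kingPrV L i.kk i.r (cvM d L i.m i.kk hL)) A' μ x :=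
    fun μ x => gavgM_conjTranspose_of_skew (kingPrV L i.kk i.r (cvM d L i.m i.kk hL)) hskew μ x
  have hĀ : ∀ μ x, ‖gavgM (Matrix mm mm ℂ) (Fin (d + 1)) (kingPrV L i.kk i.r (cvM d L i.m i.kk hL)) A' μ x‖ ≤ c35 * (L : ℝ) ^ i.m * α₀ :=
    fun μ x => (l2_opNorm_le_frobenius_norm _).trans (norm_gavgM_le_of_norm_le d mm hL i hrA0 h1F μ x)
  obtain ⟨⟨hG1c, hA1c, hD1c, hS1c⟩, ⟨hG1f, hA1f, hD1f, hS1f⟩, hP⟩ := hF i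
  obtain ⟨hPc, hPf⟩ := hP α₀ hα₀ hMaP A' hA'
  -- n15-c∕218 on both grids
  have keyC := hasMaj_landauCov_sub_exp_of_flat (cvM d L i.m i.kk hL) (L ^ i.kk) L i.kk e hĀs hrA0 hĀ hδF hCG hCA hCD hCS hP0 hG1c hA1c hD1c hS1c hPc hrT
  have keyF := hasMaj_landauCov_sub_exp_of_flat (cvM d L i.m i.kk hL) (L ^ i.r * L ^ i.kk) L i.kk e hskew hrA0 h1 hδF hCG hCA hCD hCS hP0 hG1f hA1f hD1f hS1f hPf hrT
  have hd0 := unitTorusGeo_dist_nonneg L i.kk (cvM d L i.m i.kk hL)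
  -- unitarity and masses
  have hUc : ∀ ν (p : CvX d L i.m i.kk hL), ((fun μ x => NormedSpace.exp (((((L ^ i.kk : ℕ) : ℝ))⁻¹) • gavgM (Matrix mm mm ℂ) (Fin (d + 1)) (kingPrV L i.kk i.r (cvM d L i.m i.kk hL)) A' μ x)) ν p)ᴴ * (fun μ x => NormedSpace.exp (((((L ^ i.kk : ℕ) : ℝ))⁻¹) • gavgM (Matrix mm mm ℂ) (Fin (d + 1)) (kingPrV L i.kk i.r (cvM d L i.m i.kk hL)) A' μ x)) ν p = 1 := fun ν p => exp_smul_unitary_of_conjTranspose (hĀs ν p) _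
  have hUf : ∀ ν (p : CvX' d L i.m i.kk i.r hL), ((fun μ x' => NormedSpace.exp (((((L ^ i.r * L ^ i.kk : ℕ) : ℝ))⁻¹) • A' μ x')) ν p)ᴴ * (fun μ x' => NormedSpace.exp (((((L ^ i.r * L ^ i.kk : ℕ) : ℝ))⁻¹) • A' μ x')) ν p = 1 := fun ν p => exp_smul_unitary_of_conjTranspose (hskew ν p) _
  have hTc := isUnit_cvT₀ e hUc
  have hTf := isUnit_cvT₀ e hUf
  have haC : (0 : ℝ) < (((L ^ i.kk : ℕ) : ℝ) ^ (d + 1)) := pow_pos (Nat.cast_pos.mpr (pow_pos hLpos _)) _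
  have haF : (0 : ℝ) < (((L ^ i.r * L ^ i.kk : ℕ) : ℝ) ^ (d + 1)) := pow_pos (Nat.cast_pos.mpr (Nat.mul_pos (pow_pos hLpos _) (pow_pos hLpos _))) _
  refine ⟨?_, ?_, ?_⟩
  · -- the coarse global row
    rw [cvNVr, cvLandau, landauCov_eq_of_mass _ _ hTc ha haC, ← landauCov_one_eq _ _ haC ι, ← mulVecLin_sub']
    exact keyC.of_rate_le hd0 (mul_nonneg hcR hrA0) (min_le_left _ _)
  · -- the fine global row: the knit's fine block map IS King's block map at the fine spacing
    have hBN : BlockNorm.ofBlocks (unitTorusGeo L i.kk (cvM d L i.m i.kk hL)) (liftBlk (cvBlk d L i.m i.kk hL ∘ (kingPrV L i.kk i.r (cvM d L i.m i.kk hL))) ι) =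
        BlockNorm.ofBlocks (unitTorusGeo L i.kk (cvM d L i.m i.kk hL)) (liftBlk (fun b : Tor (fine (L ^ i.r * L ^ i.kk) (cvM d L i.m i.kk hL)) × Fin (d + 1) => blockOf (L ^ i.r * L ^ i.kk) (cvM d L i.m i.kk hL) b.1) ι) := by
      congr 1
      funext p
      exact congrFun (blkFine_comp_kingPrV (cvM d L i.m i.kk hL) L i.kk i.r) p.1
    rw [hBN, cvNVr', cvLandau', landauCov_eq_of_mass _ _ hTf ha haF, ← landauCov_one_eq _ _ haF ι, ← mulVecLin_sub']
    exact keyF.of_rate_le hd0 (mul_nonneg hcR hrA0) (min_le_left _ _)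
  · -- the two-grid defect row (displayed)
    exact (hD i α₀ hα₀ hMaD A' hA').of_rate_le hd0 (mul_nonneg hCR (Real.rpow_nonneg (pow_pos hLr _).le _)) (min_le_right _ _)

/-- ★★★ (v1.1, MASS WINDOW: the flat rows and the gradient differences at any masses `a_w·n^{d+1}`, `0 < a_w ≤ 1`, per index and grid — the form of the King-model rung `fineOp n M a_K n² 0`.)  **NE2⁺, OPERATOR LAYER, BY NAME, FOR THE GLUED FAMILY WITH BAŁABAN's FULLY COVARIANT SUMMAND LIVE — THE LANDAU LETTER's ONE-GRID ROWS DERIVED FROM PRIMITIVE PROPAGATOR ROWS.**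
n15-c∕207b fed, for every index and class-(3.35) field below the threshold, by n15-c∕218 on both grids (mass moved by n15-c∕210): displayed are the FOUR FLAT rows per grid at the unit-weight
mass (`hF`, first two blocks), the ONE covariant gradient-difference row per grid (`hF`, third block), the two-grid η-defect row (`hD`) and entries 1–3 (`hE`).  MODEL family; NOT [B9] Thm 3.1∕3.14 as printed.
[cite: Balaban1985BackgroundPropagators, Thm 3.1 (3.42) p.397, Thm 3.2 (3.48) p.398, (3.49) p.399, Thm 3.4 p.400, (3.25)–(3.26) pp.394–395, (3.35)–(3.37) p.396, Thm 3.14 pp.426–427; Balaban1984PropagatorsII, Props. 2.2–2.3 pp.228–231 (the flat rows' shape); King1986, Prop. 3.9 (3.73) p.665] -/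
theorem ne2PlusOperator_sfqr_of_flatRows_mass (hL : Odd L ∧ 1 < L) (hL7 : 7 ≤ L) {a : ℝ} (ha : 0 < a) {c35 : ℝ} (hc35 : 0 < c35) (he : ∀ A B : Matrix mm mm ℂ, traceForm A B = e A ⬝ᵥ e B)
    (E : ∀ i : SfIdx d L, Fin 4 → (Fin (d + 1) → CvX' d L i.m i.kk i.r hL → Matrix mm mm ℂ) → ((CvX d L i.m i.kk hL × ι → ℝ) →ₗ[ℝ] (CvX' d L i.m i.kk i.r hL × ι → ℝ)))
    (hE : ∃ M₁ δ₁ a₁ B₁ γ₁ : ℝ, 0 < M₁ ∧ 0 < δ₁ ∧ 0 < a₁ ∧ 0 < B₁ ∧ 0 < γ₁ ∧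
      ∀ i : SfIdx d L, M₁ ≤ (L : ℝ) ^ i.m → ∀ α₀ : ℝ, 0 < α₀ → (L : ℝ) ^ i.m * α₀ ≤ a₁ →
        ∀ A' : Fin (d + 1) → CvX' d L i.m i.kk i.r hL → Matrix mm mm ℂ, (sfInstance d mm ι hL i).Bf.Reg335 c35 α₀ A' → ∀ n : Fin 4, n ≠ 0 →
          HasMaj (BlockNorm.ofBlocks (sfGeo d hL i) (liftBlk (cvBlk d L i.m i.kk hL) ι))
            (BlockNorm.ofBlocks (sfGeo d hL i) (liftBlk (cvBlk d L i.m i.kk hL ∘ kingPrV L i.kk i.r (cvM d L i.m i.kk hL)) ι)) (E i n A')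
            (fun y y' => B₁ * B9.pref4 ((opGeo (sfGeo d hL i) (CvX d L i.m i.kk hL × ι) (liftBlk (cvBlk d L i.m i.kk hL) ι)).len y) n * Real.exp (-(δ₁ * (sfGeo d hL i).dist y y')) *
              max (rateFactor (opGeo (sfGeo d hL i) (CvX d L i.m i.kk hL × ι) (liftBlk (cvBlk d L i.m i.kk hL) ι)) γ₁ y)
                (rateFactor (opGeo (sfGeo d hL i) (CvX d L i.m i.kk hL × ι) (liftBlk (cvBlk d L i.m i.kk hL) ι)) γ₁ y')))
    (hF : ∃ δF CG CA CD CS P0 aP : ℝ, 0 < δF ∧ 0 ≤ CG ∧ 0 ≤ CA ∧ 0 ≤ CD ∧ 0 ≤ CS ∧ 0 ≤ P0 ∧ 0 < aP ∧ ∀ i : SfIdx d L, ∃ awC awF : ℝ, 0 < awC ∧ awC ≤ 1 ∧ 0 < awF ∧ awF ≤ 1 ∧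
        (HasMaj (BlockNorm.ofBlocks (unitTorusGeo L i.kk (cvM d L i.m i.kk hL)) (liftBlk (blockOf (L ^ i.kk) (cvM d L i.m i.kk hL)) ι)) (BlockNorm.ofBlocks (unitTorusGeo L i.kk (cvM d L i.m i.kk hL)) (liftBlk (blockOf (L ^ i.kk) (cvM d L i.m i.kk hL)) ι)) (Matrix.mulVecLin (cGreen (cvM d L i.m i.kk hL) (L ^ i.kk) (fun (_ : Fin (d + 1)) (_ : Tor (fine (L ^ i.kk) (cvM d L i.m i.kk hL))) => (1 : Matrix ι ι ℝ)) (awC * ((L ^ i.kk : ℕ) : ℝ) ^ (d + 1)))) (fun y y' => CG * Real.exp (-(δF * (unitTorusGeo L i.kk (cvM d L i.m i.kk hL)).dist y y'))) ∧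
          HasMaj (BlockNorm.ofBlocks (unitTorusGeo L i.kk (cvM d L i.m i.kk hL)) (liftBlk (fun b : Tor (fine (L ^ i.kk) (cvM d L i.m i.kk hL)) × Fin (d + 1) => blockOf (L ^ i.kk) (cvM d L i.m i.kk hL) b.1) ι)) (BlockNorm.ofBlocks (unitTorusGeo L i.kk (cvM d L i.m i.kk hL)) (liftBlk (blockOf (L ^ i.kk) (cvM d L i.m i.kk hL)) ι)) (Matrix.mulVecLin (cGreen (cvM d L i.m i.kk hL) (L ^ i.kk) (fun (_ : Fin (d + 1)) (_ : Tor (fine (L ^ i.kk) (cvM d L i.m i.kk hL))) => (1 : Matrix ι ι ℝ)) (awC * ((L ^ i.kk : ℕ) : ℝ) ^ (d + 1)) * (cgrad (cvM d L i.m i.kk hL) (L ^ i.kk) (fun (_ : Fin (d + 1)) (_ : Tor (fine (L ^ i.kk) (cvM d L i.m i.kk hL))) => (1 : Matrix ι ι ℝ)))ᵀ)) (fun y y' => CA * Real.exp (-(δF * (unitTorusGeo L i.kk (cvM d L i.m i.kk hL)).dist y y'))) ∧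
          HasMaj (BlockNorm.ofBlocks (unitTorusGeo L i.kk (cvM d L i.m i.kk hL)) (liftBlk (blockOf (L ^ i.kk) (cvM d L i.m i.kk hL)) ι)) (BlockNorm.ofBlocks (unitTorusGeo L i.kk (cvM d L i.m i.kk hL)) (liftBlk (fun b : Tor (fine (L ^ i.kk) (cvM d L i.m i.kk hL)) × Fin (d + 1) => blockOf (L ^ i.kk) (cvM d L i.m i.kk hL) b.1) ι)) (Matrix.mulVecLin (cgrad (cvM d L i.m i.kk hL) (L ^ i.kk) (fun (_ : Fin (d + 1)) (_ : Tor (fine (L ^ i.kk) (cvM d L i.m i.kk hL))) => (1 : Matrix ι ι ℝ)) * cGreen (cvM d L i.m i.kk hL) (L ^ i.kk) (fun (_ : Fin (d + 1)) (_ : Tor (fine (L ^ i.kk) (cvM d L i.m i.kk hL))) => (1 : Matrix ι ι ℝ)) (awC * ((L ^ i.kk : ℕ) : ℝ) ^ (d + 1)))) (fun y y' => CD * Real.exp (-(δF * (unitTorusGeo L i.kk (cvM d L i.m i.kk hL)).dist y y'))) ∧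
          HasMaj (BlockNorm.ofBlocks (unitTorusGeo L i.kk (cvM d L i.m i.kk hL)) (liftBlk (fun y : Tor (cvM d L i.m i.kk hL) => y) ι)) (BlockNorm.ofBlocks (unitTorusGeo L i.kk (cvM d L i.m i.kk hL)) (liftBlk (fun y : Tor (cvM d L i.m i.kk hL) => y) ι)) (Matrix.mulVecLin (cSop (cvM d L i.m i.kk hL) (L ^ i.kk) (fun (_ : Fin (d + 1)) (_ : Tor (fine (L ^ i.kk) (cvM d L i.m i.kk hL))) => (1 : Matrix ι ι ℝ)) (awC * ((L ^ i.kk : ℕ) : ℝ) ^ (d + 1)))⁻¹) (fun y y' => CS * ((L ^ i.kk : ℕ) : ℝ) ^ (d + 1) * Real.exp (-(δF * (unitTorusGeo L i.kk (cvM d L i.m i.kk hL)).dist y y')))) ∧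
        (HasMaj (BlockNorm.ofBlocks (unitTorusGeo L i.kk (cvM d L i.m i.kk hL)) (liftBlk (blockOf (L ^ i.r * L ^ i.kk) (cvM d L i.m i.kk hL)) ι)) (BlockNorm.ofBlocks (unitTorusGeo L i.kk (cvM d L i.m i.kk hL)) (liftBlk (blockOf (L ^ i.r * L ^ i.kk) (cvM d L i.m i.kk hL)) ι)) (Matrix.mulVecLin (cGreen (cvM d L i.m i.kk hL) (L ^ i.r * L ^ i.kk) (fun (_ : Fin (d + 1)) (_ : Tor (fine (L ^ i.r * L ^ i.kk) (cvM d L i.m i.kk hL))) => (1 : Matrix ι ι ℝ)) (awF * ((L ^ i.r * L ^ i.kk : ℕ) : ℝ) ^ (d + 1)))) (fun y y' => CG * Real.exp (-(δF * (unitTorusGeo L i.kk (cvM d L i.m i.kk hL)).dist y y'))) ∧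
          HasMaj (BlockNorm.ofBlocks (unitTorusGeo L i.kk (cvM d L i.m i.kk hL)) (liftBlk (fun b : Tor (fine (L ^ i.r * L ^ i.kk) (cvM d L i.m i.kk hL)) × Fin (d + 1) => blockOf (L ^ i.r * L ^ i.kk) (cvM d L i.m i.kk hL) b.1) ι)) (BlockNorm.ofBlocks (unitTorusGeo L i.kk (cvM d L i.m i.kk hL)) (liftBlk (blockOf (L ^ i.r * L ^ i.kk) (cvM d L i.m i.kk hL)) ι)) (Matrix.mulVecLin (cGreen (cvM d L i.m i.kk hL) (L ^ i.r * L ^ i.kk) (fun (_ : Fin (d + 1)) (_ : Tor (fine (L ^ i.r * L ^ i.kk) (cvM d L i.m i.kk hL))) => (1 : Matrix ι ι ℝ)) (awF * ((L ^ i.r * L ^ i.kk : ℕ) : ℝ) ^ (d + 1)) * (cgrad (cvM d L i.m i.kk hL) (L ^ i.r * L ^ i.kk) (fun (_ : Fin (d + 1)) (_ : Tor (fine (L ^ i.r * L ^ i.kk) (cvM d L i.m i.kk hL))) => (1 : Matrix ι ι ℝ)))ᵀ)) (fun y y' => CA * Real.exp (-(δF * (unitTorusGeo L i.kk (cvM d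 L i.m i.kk hL)).dist y y'))) ∧
          HasMaj (BlockNorm.ofBlocks (unitTorusGeo L i.kk (cvM d L i.m i.kk hL)) (liftBlk (blockOf (L ^ i.r * L ^ i.kk) (cvM d L i.m i.kk hL)) ι)) (BlockNorm.ofBlocks (unitTorusGeo L i.kk (cvM d L i.m i.kk hL)) (liftBlk (fun b : Tor (fine (L ^ i.r * L ^ i.kk) (cvM d L i.m i.kk hL)) × Fin (d + 1) => blockOf (L ^ i.r * L ^ i.kk) (cvM d L i.m i.kk hL) b.1) ι)) (Matrix.mulVecLin (cgrad (cvM d L i.m i.kk hL) (L ^ i.r * L ^ i.kk) (fun (_ : Fin (d + 1)) (_ : Tor (fine (L ^ i.r * L ^ i.kk) (cvM d L i.m i.kk hL))) => (1 : Matrix ι ι ℝ)) * cGreen (cvM d L i.m i.kk hL) (L ^ i.r * L ^ i.kk) (fun (_ : Fin (d + 1)) (_ : Tor (fine (L ^ i.r * L ^ i.kk) (cvM d L i.m i.kk hL))) => (1 : Matrix ι ι ℝ)) (awF * ((L ^ i.r * L ^ i.kk : ℕ) : ℝ) ^ (d + 1)))) (fun y y' => CD * Real.exp (-(δF * (unitTorusGeo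 L i.kk (cvM d L i.m i.kk hL)).dist y y'))) ∧
          HasMaj (BlockNorm.ofBlocks (unitTorusGeo L i.kk (cvM d L i.m i.kk hL)) (liftBlk (fun y : Tor (cvM d L i.m i.kk hL) => y) ι)) (BlockNorm.ofBlocks (unitTorusGeo L i.kk (cvM d L i.m i.kk hL)) (liftBlk (fun y : Tor (cvM d L i.m i.kk hL) => y) ι)) (Matrix.mulVecLin (cSop (cvM d L i.m i.kk hL) (L ^ i.r * L ^ i.kk) (fun (_ : Fin (d + 1)) (_ : Tor (fine (L ^ i.r * L ^ i.kk) (cvM d L i.m i.kk hL))) => (1 : Matrix ι ι ℝ)) (awF * ((L ^ i.r * L ^ i.kk : ℕ) : ℝ) ^ (d + 1)))⁻¹) (fun y y' => CS * ((L ^ i.r * L ^ i.kk : ℕ) : ℝ) ^ (d + 1) * Real.exp (-(δF * (unitTorusGeo L i.kk (cvM d L i.m i.kk hL)).dist y y')))) ∧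
        (∀ α₀ : ℝ, 0 < α₀ → (L : ℝ) ^ i.m * α₀ ≤ aP → ∀ A' : Fin (d + 1) → CvX' d L i.m i.kk i.r hL → Matrix mm mm ℂ, (sfInstance d mm ι hL i).Bf.Reg335 c35 α₀ A' →
          HasMaj (BlockNorm.ofBlocks (unitTorusGeo L i.kk (cvM d L i.m i.kk hL)) (liftBlk (blockOf (L ^ i.kk) (cvM d L i.m i.kk hL)) ι)) (BlockNorm.ofBlocks (unitTorusGeo L i.kk (cvM d L i.m i.kk hL)) (liftBlk (fun b : Tor (fine (L ^ i.kk) (cvM d L i.m i.kk hL)) × Fin (d + 1) => blockOf (L ^ i.kk) (cvM d L i.m i.kk hL) b.1) ι)) (Matrix.mulVecLin (cgrad (cvM d L i.m i.kk hL) (L ^ i.kk) (cvT₀ e (fun μ x => NormedSpace.exp (((((L ^ i.kk : ℕ) : ℝ))⁻¹) • gavgM (Matrix mm mm ℂ) (Fin (d + 1)) (kingPrV L i.kk i.r (cvM d L i.m i.kk hL)) A' μ x))) * cGreen (cvM d L i.m i.kk hL) (L ^ i.kk) (cvT₀ e (fun μ x => NormedSpace.exp (((((L ^ i.kk : ℕ)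 : ℝ))⁻¹) • gavgM (Matrix mm mm ℂ) (Fin (d + 1)) (kingPrV L i.kk i.r (cvM d L i.m i.kk hL)) A' μ x))) (awC * ((L ^ i.kk : ℕ) : ℝ) ^ (d + 1)) - cgrad (cvM d L i.m i.kk hL) (L ^ i.kk) (fun (_ : Fin (d + 1)) (_ : Tor (fine (L ^ i.kk) (cvM d L i.m i.kk hL))) => (1 : Matrix ι ι ℝ)) * cGreen (cvM d L i.m i.kk hL) (L ^ i.kk) (fun (_ : Fin (d + 1)) (_ : Tor (fine (L ^ i.kk) (cvM d L i.m i.kk hL))) => (1 : Matrix ι ι ℝ)) (awC * ((L ^ i.kk : ℕ) : ℝ) ^ (d + 1)))) (fun y y' => P0 * (c35 * (L : ℝ) ^ i.m * α₀) * Real.exp (-(δF * (unitTorusGeo L i.kk (cvM d L i.m i.kk hL)).dist y y'))) ∧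
          HasMaj (BlockNorm.ofBlocks (unitTorusGeo L i.kk (cvM d L i.m i.kk hL)) (liftBlk (blockOf (L ^ i.r * L ^ i.kk) (cvM d L i.m i.kk hL)) ι)) (BlockNorm.ofBlocks (unitTorusGeo L i.kk (cvM d L i.m i.kk hL)) (liftBlk (fun b : Tor (fine (L ^ i.r * L ^ i.kk) (cvM d L i.m i.kk hL)) × Fin (d + 1) => blockOf (L ^ i.r * L ^ i.kk) (cvM d L i.m i.kk hL) b.1) ι)) (Matrix.mulVecLin (cgrad (cvM d L i.m i.kk hL) (L ^ i.r * L ^ i.kk) (cvT₀ e (fun μ x' => NormedSpace.exp (((((L ^ i.r * L ^ i.kk : ℕ) : ℝ))⁻¹) • A' μ x'))) * cGreen (cvM d L i.m i.kk hL) (L ^ i.r * L ^ i.kk) (cvT₀ e (fun μ x' => NormedSpace.exp (((((L ^ i.r * L ^ i.kk : ℕ) : ℝ))⁻¹) • A' μ x'))) (awF * ((L ^ i.r * L ^ i.kk : ℕ) : ℝ) ^ (d + 1)) - cgrad (cvM d L i.m i.kk hL) (L ^ i.r * L ^ i.kk) (fun (_ : Fin (d + 1)) (_ : Tor (fine (L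 ^ i.r * L ^ i.kk) (cvM d L i.m i.kk hL))) => (1 : Matrix ι ι ℝ)) * cGreen (cvM d L i.m i.kk hL) (L ^ i.r * L ^ i.kk) (fun (_ : Fin (d + 1)) (_ : Tor (fine (L ^ i.r * L ^ i.kk) (cvM d L i.m i.kk hL))) => (1 : Matrix ι ι ℝ)) (awF * ((L ^ i.r * L ^ i.kk : ℕ) : ℝ) ^ (d + 1)))) (fun y y' => P0 * (c35 * (L : ℝ) ^ i.m * α₀) * Real.exp (-(δF * (unitTorusGeo L i.kk (cvM d L i.m i.kk hL)).dist y y')))))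
    (hD : ∃ δD CR γR aD : ℝ, 0 < δD ∧ 0 ≤ CR ∧ 0 < γR ∧ 0 < aD ∧
      ∀ i : SfIdx d L, ∀ α₀ : ℝ, 0 < α₀ → (L : ℝ) ^ i.m * α₀ ≤ aD → ∀ A' : Fin (d + 1) → CvX' d L i.m i.kk i.r hL → Matrix mm mm ℂ, (sfInstance d mm ι hL i).Bf.Reg335 c35 α₀ A' →
        HasMaj (CvNorm d L i.m i.kk hL ι) (BlockNorm.ofBlocks (unitTorusGeo L i.kk (cvM d L i.m i.kk hL)) (liftBlk (cvBlk d L i.m i.kk hL ∘ (kingPrV L i.kk i.r (cvM d L i.m i.kk hL))) ι)) (idef (pull (liftMap (kingPrV L i.kk i.r (cvM d L i.m i.kk hL)) ι)) (pull (liftMap (kingPrV L i.kk i.r (cvM d L i.m i.kk hL)) ι)) (cvNVr' d L i.m i.kk i.r hL a ι e (fun μ x' => NormedSpace.exp (((((L ^ i.r * L ^ i.kk : ℕ) : ℝ))⁻¹) • A' μ x'))) (cvNVr d L i.m i.kk hL a ι e (fun μ x => NormedSpace.exp (((((L ^ i.kk : ℕ) : ℝ))⁻¹) • gavgM (Matrix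 mm mm ℂ) (Fin (d + 1)) (kingPrV L i.kk i.r (cvM d L i.m i.kk hL)) A' μ x)))) (fun y y' => (CR * ((L : ℝ) ^ i.kk) ^ (-γR)) * Real.exp (-(δD * (unitTorusGeo L i.kk (cvM d L i.m i.kk hL)).dist y y')))) :
    NE2PlusOperator c35 (sfInstance d mm ι hL) (fun i => sfqrFamily d mm ι a e hL i (E i)) := by
  obtain ⟨δF, CG, CA, CD, CS, P0, aP, hδF, hCG, hCA, hCD, hCS, hP0, haP, hF⟩ := hF
  obtain ⟨δD, CR, γR, aD, hδD, hCR, hγR, haD, hD⟩ := hD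
  have hLpos : 0 < L := Nat.pos_of_ne_zero (NeZero.ne L)
  have hLr : (0 : ℝ) < (L : ℝ) := Nat.cast_pos.mpr hLpos
  -- the constants of n15-c∕218 (index-free)
  have hκF := @basisConst_nonneg ι _ (Matrix mm mm ℂ) Matrix.frobeniusNormedAddCommGroup Matrix.frobeniusNormedSpace e
  have hκm : (0 : ℝ) ≤ (@basisConst ι _ (Matrix mm mm ℂ) Matrix.frobeniusNormedAddCommGroup Matrix.frobeniusNormedSpace e * (2 * Real.sqrt (Fintype.card mm)) * Real.sqrt (Fintype.card mm)) := by positivity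
  have hcs : 0 ≤ B4Sect5Proof.latticeConst (d + 1) (δF / 16) := B4Sect5Proof.latticeConst_nonneg (d + 1) (by positivity)
  have hcs' : 0 ≤ B4Sect5Proof.latticeConst (d + 1) (3 * δF / 4 / 8) := B4Sect5Proof.latticeConst_nonneg (d + 1) (by positivity)
  have hS : 0 ≤ landauSmallConst ((d : ℝ) + 1) (Fintype.card ι) CG CA CD CS P0 (2 * Fintype.card ι * (@basisConst ι _ (Matrix mm mm ℂ) Matrix.frobeniusNormedAddCommGroup Matrix.frobeniusNormedSpace e * (2 * Real.sqrt (Fintype.card mm)) * Real.sqrt (Fintype.card mm))) (2 * ((d : ℝ) + 1) * (2 * Fintype.card ι * (@basisConst ι _ (Matrix mm mm ℂ) Matrix.frobeniusNormedAddCommGroup Matrix.frobeniusNormedSpace e * (2 * Real.sqrt (Fintype.card mm)) * Real.sqrt (Fintype.card mm)))) 1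
      (B4Sect5Proof.latticeConst (d + 1) (δF / 16)) δF := by
    unfold landauSmallConst CovLandau.cK1 CovLandau.cB0 CovLandau.cM2 CovLandau.cPG0 CovLandau.cA0; positivity
  have hthr : 0 < landauExpThreshold ((d : ℝ) + 1) (Fintype.card ι) (@basisConst ι _ (Matrix mm mm ℂ) Matrix.frobeniusNormedAddCommGroup Matrix.frobeniusNormedSpace e * (2 * Real.sqrt (Fintype.card mm)) * Real.sqrt (Fintype.card mm)) CG CA CD CS P0 (B4Sect5Proof.latticeConst (d + 1) (δF / 16)) δF := by
    unfold landauExpThreshold; positivity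
  have hcR : 0 ≤ landauRowConst ((d : ℝ) + 1) (Fintype.card ι) CG CA CD CS P0 (2 * Fintype.card ι * (@basisConst ι _ (Matrix mm mm ℂ) Matrix.frobeniusNormedAddCommGroup Matrix.frobeniusNormedSpace e * (2 * Real.sqrt (Fintype.card mm)) * Real.sqrt (Fintype.card mm))) (2 * ((d : ℝ) + 1) * (2 * Fintype.card ι * (@basisConst ι _ (Matrix mm mm ℂ) Matrix.frobeniusNormedAddCommGroup Matrix.frobeniusNormedSpace e * (2 * Real.sqrt (Fintype.card mm)) * Real.sqrt (Fintype.card mm)))) 1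
      (B4Sect5Proof.latticeConst (d + 1) (δF / 16)) (B4Sect5Proof.latticeConst (d + 1) (3 * δF / 4 / 8)) δF := by
    unfold landauRowConst
    exact landauLetterConst_nonneg (by positivity) (by positivity) hcs' (by positivity) (by unfold CovLandau.cM2 CovLandau.cA0; positivity) hCD hP0
      (by unfold CovLandau.cPG0 CovLandau.cA0; positivity) (by norm_num) (by positivity)
  refine ne2PlusOperator_sfqr_of_global_small d mm ι e hL hL7 ha hc35 he E hE
    ⟨min (3 * δF / 8) δD, _, CR, γR, min aP (min aD (landauExpThreshold ((d : ℝ) + 1) (Fintype.card ι) (@basisConst ι _ (Matrix mm mm ℂ) Matrix.frobeniusNormedAddCommGroup Matrix.frobeniusNormedSpace e * (2 * Real.sqrt (Fintype.card mm)) * Real.sqrt (Fintype.card mm)) CG CA CD CS P0 (B4Sect5Proof.latticeConst (d + 1) (δF / 16)) δF / c35)),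
      lt_min (by positivity) hδD, hcR, hCR, hγR, lt_min haP (lt_min haD (by positivity)), fun i α₀ hα₀ hMa A' hA' => ?_⟩
  -- the class, the sizes
  have hMaP : (L : ℝ) ^ i.m * α₀ ≤ aP := hMa.trans (min_le_left _ _)
  have hMaD : (L : ℝ) ^ i.m * α₀ ≤ aD := hMa.trans ((min_le_right _ _).trans (min_le_left _ _))
  have hMaT : (L : ℝ) ^ i.m * α₀ ≤ landauExpThreshold ((d : ℝ) + 1) (Fintype.card ι) (@basisConst ι _ (Matrix mm mm ℂ) Matrix.frobeniusNormedAddCommGroup Matrix.frobeniusNormedSpace e * (2 * Real.sqrt (Fintype.card mm)) * Real.sqrt (Fintype.card mm)) CG CA CD CS P0 (B4Sect5Proof.latticeConst (d + 1) (δF / 16)) δF / c35 :=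
    hMa.trans ((min_le_right _ _).trans (min_le_right _ _))
  have hrA0 : 0 ≤ c35 * (L : ℝ) ^ i.m * α₀ := by positivity
  have hrT : c35 * (L : ℝ) ^ i.m * α₀ ≤ landauExpThreshold ((d : ℝ) + 1) (Fintype.card ι) (@basisConst ι _ (Matrix mm mm ℂ) Matrix.frobeniusNormedAddCommGroup Matrix.frobeniusNormedSpace e * (2 * Real.sqrt (Fintype.card mm)) * Real.sqrt (Fintype.card mm)) CG CA CD CS P0 (B4Sect5Proof.latticeConst (d + 1) (δF / 16)) δF := by
    have := mul_le_mul_of_nonneg_left hMaT hc35.le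
    rw [mul_div_cancel₀ _ hc35.ne'] at this
    simpa only [mul_assoc] using this
  obtain ⟨hskew, h1F, h2F, h3F⟩ := (sfInstance_reg335_iff d mm ι hL i c35 α₀ A').1 hA'
  have h1 : ∀ μ x', ‖A' μ x'‖ ≤ c35 * (L : ℝ) ^ i.m * α₀ := fun μ x' => (l2_opNorm_le_frobenius_norm _).trans (h1F μ x')
  have hĀs : ∀ μ x, (gavgM (Matrix mm mm ℂ) (Fin (d + 1)) (kingPrV L i.kk i.r (cvM d L i.m i.kk hL)) A' μ x)ᴴ = -gavgM (Matrix mm mm ℂ) (Fin (d + 1)) (kingPrV L i.kk i.r (cvM d L i.m i.kk hL)) A' μ x :=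
    fun μ x => gavgM_conjTranspose_of_skew (kingPrV L i.kk i.r (cvM d L i.m i.kk hL)) hskew μ x
  have hĀ : ∀ μ x, ‖gavgM (Matrix mm mm ℂ) (Fin (d + 1)) (kingPrV L i.kk i.r (cvM d L i.m i.kk hL)) A' μ x‖ ≤ c35 * (L : ℝ) ^ i.m * α₀ :=
    fun μ x => (l2_opNorm_le_frobenius_norm _).trans (norm_gavgM_le_of_norm_le d mm hL i hrA0 h1F μ x)
  obtain ⟨awC, awF, hawC0, hawC1, hawF0, hawF1, ⟨hG1c, hA1c, hD1c, hS1c⟩, ⟨hG1f, hA1f, hD1f, hS1f⟩, hP⟩ := hF i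
  obtain ⟨hPc, hPf⟩ := hP α₀ hα₀ hMaP A' hA'
  -- n15-c∕218 on both grids
  have keyC := hasMaj_landauCov_sub_exp_of_flat_mass (cvM d L i.m i.kk hL) (L ^ i.kk) L i.kk e hawC0 hawC1 hĀs hrA0 hĀ hδF hCG hCA hCD hCS hP0 hG1c hA1c hD1c hS1c hPc hrT
  have keyF := hasMaj_landauCov_sub_exp_of_flat_mass (cvM d L i.m i.kk hL) (L ^ i.r * L ^ i.kk) L i.kk e hawF0 hawF1 hskew hrA0 h1 hδF hCG hCA hCD hCS hP0 hG1f hA1f hD1f hS1f hPf hrT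
  have hd0 := unitTorusGeo_dist_nonneg L i.kk (cvM d L i.m i.kk hL)
  -- unitarity and masses
  have hUc : ∀ ν (p : CvX d L i.m i.kk hL), ((fun μ x => NormedSpace.exp (((((L ^ i.kk : ℕ) : ℝ))⁻¹) • gavgM (Matrix mm mm ℂ) (Fin (d + 1)) (kingPrV L i.kk i.r (cvM d L i.m i.kk hL)) A' μ x)) ν p)ᴴ * (fun μ x => NormedSpace.exp (((((L ^ i.kk : ℕ) : ℝ))⁻¹) • gavgM (Matrix mm mm ℂ) (Fin (d + 1)) (kingPrV L i.kk i.r (cvM d L i.m i.kk hL)) A' μ x)) ν p = 1 := fun ν p => exp_smul_unitary_of_conjTranspose (hĀs ν p) _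
  have hUf : ∀ ν (p : CvX' d L i.m i.kk i.r hL), ((fun μ x' => NormedSpace.exp (((((L ^ i.r * L ^ i.kk : ℕ) : ℝ))⁻¹) • A' μ x')) ν p)ᴴ * (fun μ x' => NormedSpace.exp (((((L ^ i.r * L ^ i.kk : ℕ) : ℝ))⁻¹) • A' μ x')) ν p = 1 := fun ν p => exp_smul_unitary_of_conjTranspose (hskew ν p) _
  have hTc := isUnit_cvT₀ e hUc
  have hTf := isUnit_cvT₀ e hUf
  have haC : (0 : ℝ) < (awC * ((L ^ i.kk : ℕ) : ℝ) ^ (d + 1)) := mul_pos hawC0 (pow_pos (Nat.cast_pos.mpr (pow_pos hLpos _)) _)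
  have haF : (0 : ℝ) < (awF * ((L ^ i.r * L ^ i.kk : ℕ) : ℝ) ^ (d + 1)) := mul_pos hawF0 (pow_pos (Nat.cast_pos.mpr (Nat.mul_pos (pow_pos hLpos _) (pow_pos hLpos _))) _)
  refine ⟨?_, ?_, ?_⟩
  · -- the coarse global row
    rw [cvNVr, cvLandau, landauCov_eq_of_mass _ _ hTc ha haC, ← landauCov_one_eq _ _ haC ι, ← mulVecLin_sub']
    exact keyC.of_rate_le hd0 (mul_nonneg hcR hrA0) (min_le_left _ _)
  · -- the fine global row: the knit's fine block map IS King's block map at the fine spacing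
    have hBN : BlockNorm.ofBlocks (unitTorusGeo L i.kk (cvM d L i.m i.kk hL)) (liftBlk (cvBlk d L i.m i.kk hL ∘ (kingPrV L i.kk i.r (cvM d L i.m i.kk hL))) ι) =
        BlockNorm.ofBlocks (unitTorusGeo L i.kk (cvM d L i.m i.kk hL)) (liftBlk (fun b : Tor (fine (L ^ i.r * L ^ i.kk) (cvM d L i.m i.kk hL)) × Fin (d + 1) => blockOf (L ^ i.r * L ^ i.kk) (cvM d L i.m i.kk hL) b.1) ι) := by
      congr 1
      funext p
      exact congrFun (blkFine_comp_kingPrV (cvM d L i.m i.kk hL) L i.kk i.r) p.1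
    rw [hBN, cvNVr', cvLandau', landauCov_eq_of_mass _ _ hTf ha haF, ← landauCov_one_eq _ _ haF ι, ← mulVecLin_sub']
    exact keyF.of_rate_le hd0 (mul_nonneg hcR hrA0) (min_le_left _ _)
  · -- the two-grid defect row (displayed)
    exact (hD i α₀ hα₀ hMaD A' hA').of_rate_le hd0 (mul_nonneg hCR (Real.rpow_nonneg (pow_pos hLr _).le _)) (min_le_right _ _)

end Node

end Summit.QuantumFields.YangMills.BalabanUVNodes.N15.Gluing

end
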